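import Summits.Parity.GeneralizedHardyLittlewood.Theorems.BeyondDiagonalBeatsQuarter.CornerAssembly
import Summits.Parity.GeneralizedHardyLittlewood.Theorems.BeyondDiagonalBeatsQuarter.CornerSums
import Literature.NumberTheory.LFunctions.KMVSignedSecondGap
import HarnessLib

/-!
# Route `PrimeLevelFamEdge`, crux K_B (stmt-Parity-20343), line `diagonal_kernel_split`, helper H1:
# **the corner is negligible** (`CornerNegligibleXSq`, STUB-PLAN §1.3(a)/§5/§7)

**Theorem (`abs_corner_le`, q-free form).** For every `κ > 0` there is `C` such that for all
`Q ≥ 2` and `2 ≤ M ≤ Q^{2−κ}`, with the KMV `X²` mollifier coefficients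
`x_a = μ(a)ψ(a)⁻¹(log(M/a)/log M)²` (`xsq M a`),

  `|Σ_{a,b ≤ M} x_a x_b (K_true(Q; a, b) − kmvKernel(log Q; a, b))| ≤ C / log³ M`,

where `K_true(Q;a,b) = (ab)⁻¹Σ_{c∣(a,b)} c·τ((a/c)(b/c))·𝒲((a/c)(b/c)/Q²)` is the TRUE Petersson
diagonal kernel of the mollified second moment (`trueDiagKernel`, cut-off weight
`𝒲(y) = ∫_0^∞ dv/(e^{v+y/v} − 1) = Σ_n W(n²y)/n`) and `KMV2000.kmvKernel (log Q)` the CONTINUED kernel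
(residue weight `½ log(1/y)`) of the registered line. Since the kernel form itself is `≍ 1/log² M`
(stub N, `stub_kernelFormXSq`, p602508), the corner — the difference between the true diagonal and its
continuation beyond the diagonal — is negligible for every mollifier length `M ≤ Q^{2−κ}`, i.e. for
`Δ′ = log M/log q̂ < 2`.

**Corollary (`cornerNegligibleXSq`, the critic's H1 shape).** For `1 < Δ′ < 2` and `ε > 0`, for all
large `q` (prime or not), at `M = q̂^{Δ′}`, `Q = q̂`:
`|Σ_{m₁,m₂ ≤ q̂^{Δ′}} x x (K_true − kmvKernel)| ≤ ε·mainScaleReal Δ′ q/(2q̂)`.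

Proof: parts 1–7 (`CornerWeight`, `CornerWeightE`, `CornerMoebius`, `CornerAbel`, `CornerReduction`,
`CornerAssembly`, `CornerSums`), all real-variable; see their headers.

What this is NOT: it says nothing about the off-diagonal (Kloosterman) part of the second moment, the
heart `stub_kernelExcessBelowSlack_io`, or K_B; no Landau–Siegel statement is touched. Helper toward the
heart stub (plan Ω, H1 of the STUB-PLAN), `--supports stmt-Parity-20343`; standard axioms.
«The programme SEARCHES and TYPES; no claim about Landau–Siegel zeros, Theorems 1–2 of
arXiv:2211.02515 or a repaired Margin232 until a kernel theorem says so.»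
-/

noncomputable section

open scoped Real ArithmeticFunction.Moebius
open Finset ArithmeticFunction

namespace Summit.Parity.GeneralizedHardyLittlewood.Theorems.BeyondDiagonalBeatsQuarter.Corner

open Literature.NumberTheory.LFunctions Literature.NumberTheory.LFunctions.KMV2000
open MollifierMainTerm (W)
open KernelFormXSq

/-- The purely numerical tail of the corner estimate: with `X = 1 + log Q`, `L ≤ 2 log Q`, both
amplitudes are `≪ X^{-4} ≪ L^{-3}`. [folklore] -/
theorem corner_tail_le {C₁ C₂ Cκ W₁ Z₂ κ L LQ lN q A₁ A₂ Ctot : ℝ}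
    (hC₁ : 0 < C₁) (hC₂ : 0 < C₂) (hCκ : 0 < Cκ) (hW₁0 : 0 ≤ W₁) (hZ₂0 : 0 ≤ Z₂) (hκ : 0 < κ)
    (hLQ : 1 / 2 < LQ) (hL0 : 0 < L) (hLLQ : L ≤ 2 * LQ) (hlN0 : 0 ≤ lN) (hlN : lN ≤ L)
    (hq0 : 0 ≤ q) (hq : q ≤ Cκ / (1 + LQ) ^ 10)
    (hA₁ : A₁ = 2 * (1 + L) ^ 2 * (C₁ * (Real.sqrt 2 * q)))
    (hA₂ : A₂ = 2 * (1 + L) ^ 2 * (2 * (C₂ * (2 / κ) ^ 12 / LQ ^ 12) * (W₁ + 2 + 4 * L + 2 * LQ)))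
    (hCtot : Ctot = 32 * (128 * Real.sqrt 2 * C₁ * Cκ + 32 * C₂ * (6 / κ) ^ 12 * (W₁ + 10) * Z₂ + 1)) :
    A₁ * (1 + lN) ^ 4 + A₂ * (Z₂ * (2 + lN)) ≤ Ctot / L ^ 3 := by
  have hLQ0 : 0 < LQ := by linarith
  set X : ℝ := 1 + LQ with hX
  have hX1 : 1 ≤ X := by rw [hX]; linarith
  have hX0 : 0 < X := by linarith
  have hLX : 1 + L ≤ 2 * X := by rw [hX]; linarith
  have hNX : 1 + lN ≤ 2 * X := by linarith
  have hNX' : 2 + lN ≤ 2 * X := by rw [hX]; linarith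
  have hLQX : X ≤ 3 * LQ := by rw [hX]; linarith
  have hGX : W₁ + 2 + 4 * L + 2 * LQ ≤ (W₁ + 10) * X := by rw [hX]; nlinarith
  have hXL : L ≤ 2 * X := by rw [hX]; linarith
  have hpowX : (1 + L) ^ 2 ≤ (2 * X) ^ 2 := pow_le_pow_left₀ (by linarith) hLX 2
  -- A₁-term
  have hA₁le : A₁ * (1 + lN) ^ 4 ≤ 128 * Real.sqrt 2 * C₁ * Cκ / X ^ 4 := by
    have hq' : C₁ * (Real.sqrt 2 * q) ≤ C₁ * (Real.sqrt 2 * (Cκ / X ^ 10)) :=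
      mul_le_mul_of_nonneg_left (mul_le_mul_of_nonneg_left hq (Real.sqrt_nonneg 2)) hC₁.le
    have h1 : A₁ ≤ 2 * (2 * X) ^ 2 * (C₁ * (Real.sqrt 2 * (Cκ / X ^ 10))) := by
      rw [hA₁]
      exact mul_le_mul (mul_le_mul_of_nonneg_left hpowX zero_le_two) hq' (by positivity) (by positivity)
    have h2 : (1 + lN) ^ 4 ≤ (2 * X) ^ 4 := pow_le_pow_left₀ (by linarith) hNX 4
    have h3 : 2 * (2 * X) ^ 2 * (C₁ * (Real.sqrt 2 * (Cκ / X ^ 10))) * (2 * X) ^ 4 =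
        128 * Real.sqrt 2 * C₁ * Cκ / X ^ 4 := by
      rw [eq_div_iff (pow_ne_zero 4 hX0.ne')]
      have : Cκ / X ^ 10 * X ^ 10 = Cκ := div_mul_cancel₀ Cκ (pow_ne_zero 10 hX0.ne')
      calc 2 * (2 * X) ^ 2 * (C₁ * (Real.sqrt 2 * (Cκ / X ^ 10))) * (2 * X) ^ 4 * X ^ 4
          = 128 * Real.sqrt 2 * C₁ * (Cκ / X ^ 10 * X ^ 10) := by ring
        _ = 128 * Real.sqrt 2 * C₁ * Cκ := by rw [this]
    calc A₁ * (1 + lN) ^ 4 ≤ 2 * (2 * X) ^ 2 * (C₁ * (Real.sqrt 2 * (Cκ / X ^ 10))) * (2 * X) ^ 4 :=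
          mul_le_mul h1 h2 (by positivity) (by positivity)
      _ = 128 * Real.sqrt 2 * C₁ * Cκ / X ^ 4 := h3
  -- A₂-term
  have hA₂le : A₂ * (Z₂ * (2 + lN)) ≤ 32 * C₂ * (6 / κ) ^ 12 * (W₁ + 10) * Z₂ / X ^ 8 := by
    have hLQinv : C₂ * (2 / κ) ^ 12 / LQ ^ 12 ≤ C₂ * (6 / κ) ^ 12 / X ^ 12 := by
      rw [div_le_div_iff₀ (by positivity) (by positivity)]
      have : (2 / κ) ^ 12 * X ^ 12 ≤ (6 / κ) ^ 12 * LQ ^ 12 := by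
        rw [← mul_pow, ← mul_pow]
        apply pow_le_pow_left₀ (by positivity)
        rw [show 6 / κ * LQ = 2 / κ * (3 * LQ) by ring]
        exact mul_le_mul_of_nonneg_left hLQX (by positivity)
      nlinarith [hC₂]
    have hin : 2 * (C₂ * (2 / κ) ^ 12 / LQ ^ 12) * (W₁ + 2 + 4 * L + 2 * LQ) ≤
        2 * (C₂ * (6 / κ) ^ 12 / X ^ 12) * ((W₁ + 10) * X) :=
      mul_le_mul (mul_le_mul_of_nonneg_left hLQinv zero_le_two) hGX (by positivity) (by positivity)
    have h1 : A₂ ≤ 2 * (2 * X) ^ 2 * (2 * (C₂ * (6 / κ) ^ 12 / X ^ 12) * ((W₁ + 10) * X)) := by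
      rw [hA₂]
      exact mul_le_mul (mul_le_mul_of_nonneg_left hpowX zero_le_two) hin (by positivity) (by positivity)
    have h3 : 2 * (2 * X) ^ 2 * (2 * (C₂ * (6 / κ) ^ 12 / X ^ 12) * ((W₁ + 10) * X)) * (Z₂ * (2 * X)) =
        32 * C₂ * (6 / κ) ^ 12 * (W₁ + 10) * Z₂ / X ^ 8 := by
      rw [eq_div_iff (pow_ne_zero 8 hX0.ne')]
      have : C₂ * (6 / κ) ^ 12 / X ^ 12 * X ^ 12 = C₂ * (6 / κ) ^ 12 :=
        div_mul_cancel₀ _ (pow_ne_zero 12 hX0.ne')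
      calc 2 * (2 * X) ^ 2 * (2 * (C₂ * (6 / κ) ^ 12 / X ^ 12) * ((W₁ + 10) * X)) * (Z₂ * (2 * X)) * X ^ 8
          = 32 * (W₁ + 10) * Z₂ * (C₂ * (6 / κ) ^ 12 / X ^ 12 * X ^ 12) := by ring
        _ = 32 * C₂ * (6 / κ) ^ 12 * (W₁ + 10) * Z₂ := by rw [this]; ring
    calc A₂ * (Z₂ * (2 + lN)) ≤
        2 * (2 * X) ^ 2 * (2 * (C₂ * (6 / κ) ^ 12 / X ^ 12) * ((W₁ + 10) * X)) * (Z₂ * (2 * X)) :=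
          mul_le_mul h1 (mul_le_mul_of_nonneg_left hNX' hZ₂0) (by positivity) (by positivity)
      _ = 32 * C₂ * (6 / κ) ^ 12 * (W₁ + 10) * Z₂ / X ^ 8 := h3
  -- X ≥ L/2
  have hX4 : 1 / X ^ 4 ≤ 32 / L ^ 3 := by
    rw [div_le_div_iff₀ (by positivity) (by positivity), one_mul]
    have hL3 : L ^ 3 ≤ (2 * X) ^ 3 := pow_le_pow_left₀ hL0.le hXL 3
    have hX3 : 0 < X ^ 3 := pow_pos hX0 3
    have h8 : 8 * X ^ 3 ≤ 32 * X ^ 4 := by nlinarith only [hX3, hX1]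
    nlinarith only [hL3, h8]
  have hX8 : 1 / X ^ 8 ≤ 1 / X ^ 4 :=
    div_le_div_of_nonneg_left zero_le_one (by positivity) (pow_le_pow_right₀ hX1 (by norm_num))
  set T₁ : ℝ := 128 * Real.sqrt 2 * C₁ * Cκ with hT₁
  set T₂ : ℝ := 32 * C₂ * (6 / κ) ^ 12 * (W₁ + 10) * Z₂ with hT₂
  have hT₁0 : 0 ≤ T₁ := by positivity
  have hT₂0 : 0 ≤ T₂ := by positivity
  calc A₁ * (1 + lN) ^ 4 + A₂ * (Z₂ * (2 + lN))
      ≤ T₁ / X ^ 4 + T₂ / X ^ 8 := add_le_add hA₁le hA₂le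
    _ = T₁ * (1 / X ^ 4) + T₂ * (1 / X ^ 8) := by ring
    _ ≤ T₁ * (32 / L ^ 3) + T₂ * (32 / L ^ 3) :=
        add_le_add (mul_le_mul_of_nonneg_left hX4 hT₁0) (mul_le_mul_of_nonneg_left (hX8.trans hX4) hT₂0)
    _ = 32 * (T₁ + T₂) / L ^ 3 := by ring
    _ ≤ Ctot / L ^ 3 := by
        apply div_le_div_of_nonneg_right _ (by positivity)
        rw [hCtot, hT₁, hT₂]
        linarith only []
set_option maxHeartbeats 400000 in -- buildfix (bf3-g27): 160k/180k FAIL, 200k PASS at accept time; line-neutral budget line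
/-- **H1, q-free form: the corner of the diagonal is `O(1/log³M)`.** For `κ > 0` there is `C` with
`|Σ_{a,b ≤ M} x_a x_b (trueDiagKernel Q a b − kmvKernel (log Q) a b)| ≤ C/log³M` whenever `Q ≥ 2` and
`2 ≤ M ≤ Q^{2−κ}` (`x = xsq M`, the KMV `X²` coefficients).
[cite: KowalskiMichelVanderKam2000, (21)–(23) pp. 12–13 and Prop. 5.1 p. 18 — derivation (the corner of the diagonal beyond the diagonal, P = X²)] -/
theorem abs_corner_le {κ : ℝ} (hκ : 0 < κ) :
    ∃ C : ℝ, 0 < C ∧ ∀ Q M : ℝ, 2 ≤ Q → 2 ≤ M → M ≤ Q ^ (2 - κ) →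
      |∑ a ∈ Icc 1 ⌊M⌋₊, ∑ b ∈ Icc 1 ⌊M⌋₊,
          xsq M a * xsq M b * (trueDiagKernel Q a b - kmvKernel (Real.log Q) a b)| ≤
        C / Real.log M ^ 3 := by
  obtain ⟨C₁, C₂, hC₁, hC₂, hU⟩ := abs_cornerU_le
  obtain ⟨Cκ, hCκ, hCκb⟩ := rpow_neg_le_div_log_pow (show 0 < κ / 4 by positivity) 10
  set Z₂ : ℝ := (∑' d : ℕ, (d : ℝ) ^ (-(5 / 4 : ℝ))) ^ 2 with hZ₂
  set W₁ : ℝ := scriptW 1 with hW₁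
  have hW₁0 : 0 ≤ W₁ := scriptW_nonneg zero_le_one
  have hZ₂0 : 0 ≤ Z₂ := sq_nonneg _
  -- the final constant
  set Ctot : ℝ := 32 * (128 * Real.sqrt 2 * C₁ * Cκ + 32 * C₂ * (6 / κ) ^ 12 * (W₁ + 10) * Z₂ + 1)
    with hCtot
  refine ⟨Ctot, by positivity, fun Q M hQ2 hM2 hMQ ↦ ?_⟩
  -- notation and basic facts
  have hQ1 : 1 ≤ Q := by linarith
  have hQ0 : 0 < Q := by linarith
  have hM1 : 1 ≤ M := by linarith
  have hM0 : 0 < M := by linarith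
  set N : ℕ := ⌊M⌋₊ with hNdef
  have hN1 : 1 ≤ N := Nat.le_floor (by simpa using hM1)
  have hNM : (N : ℝ) ≤ M := Nat.floor_le hM0.le
  set L : ℝ := Real.log M with hLdef
  set LQ : ℝ := Real.log Q with hLQdef
  have hl2 : (1 : ℝ) / 2 < Real.log 2 := by have := Real.log_two_gt_d9; linarith
  have hL2 : Real.log 2 ≤ L := Real.log_le_log two_pos hM2
  have hLQ2 : Real.log 2 ≤ LQ := Real.log_le_log two_pos hQ2
  have hL0 : 0 < L := by linarith
  have hLQ0 : 0 < LQ := by linarith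
  have hLLQ : L ≤ 2 * LQ := by
    have := Real.log_le_log hM0 hMQ
    rw [Real.log_rpow hQ0] at this
    nlinarith
  have hlogN : Real.log N ≤ L := Real.log_le_log (by exact_mod_cast hN1) hNM
  have hlogN0 : 0 ≤ Real.log N := Real.log_nonneg (by exact_mod_cast hN1)
  -- the threshold
  obtain ⟨hK1, hKQ, hKlog⟩ := floor_rpow_facts hQ1 (show 0 < κ / 2 by positivity)
  set K₁ : ℕ := ⌊Q ^ (κ / 2)⌋₊ with hK₁def
  have hKlog' : 0 < 1 + Real.log (K₁ : ℝ) := by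
    have : 0 ≤ Real.log (K₁ : ℝ) := Real.log_natCast_nonneg K₁; linarith
  -- (c) 1/(1+log K₁)^12 ≤ (2/κ)^12 / LQ^12
  have hcK : C₂ / (1 + Real.log (K₁ : ℝ)) ^ 12 ≤ C₂ * (2 / κ) ^ 12 / LQ ^ 12 := by
    have hx0 : LQ ≤ 2 / κ * (1 + Real.log (K₁ : ℝ)) := by
      have := mul_le_mul_of_nonneg_left hKlog (show (0 : ℝ) ≤ 2 / κ by positivity)
      rwa [show 2 / κ * (κ / 2 * Real.log Q) = LQ by rw [hLQdef]; field_simp] at this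
    have hx : LQ ^ 12 ≤ (2 / κ * (1 + Real.log (K₁ : ℝ))) ^ 12 := pow_le_pow_left₀ hLQ0.le hx0 12
    rw [div_le_div_iff₀ (by positivity) (by positivity), mul_pow] at *
    nlinarith [hC₂]
  -- (b) √(2K₁M)/Q ≤ √2 · Q^{-κ/4}
  have hb : Real.sqrt (2 * K₁ * M) / Q ≤ Real.sqrt 2 * Q ^ (-(κ / 4)) := by
    have h1 : 2 * (K₁ : ℝ) * M ≤ 2 * (Q ^ (1 - κ / 4)) ^ 2 := by
      have hKM : (K₁ : ℝ) * M ≤ Q ^ (κ / 2) * Q ^ (2 - κ) := mul_le_mul hKQ hMQ hM0.le (by positivity)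
      have hsq : (Q ^ (1 - κ / 4)) ^ 2 = Q ^ (κ / 2) * Q ^ (2 - κ) := by
        rw [← Real.rpow_add hQ0, ← Real.rpow_natCast, ← Real.rpow_mul hQ0.le]
        congr 1; push_cast; ring
      rw [hsq]; linarith
    have h2 : Real.sqrt (2 * K₁ * M) ≤ Real.sqrt 2 * Q ^ (1 - κ / 4) := by
      calc Real.sqrt (2 * K₁ * M) ≤ Real.sqrt (2 * (Q ^ (1 - κ / 4)) ^ 2) := Real.sqrt_le_sqrt h1
        _ = Real.sqrt 2 * Q ^ (1 - κ / 4) := by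
            rw [Real.sqrt_mul (by norm_num), Real.sqrt_sq (by positivity)]
    rw [div_le_iff₀ hQ0]
    refine h2.trans (le_of_eq ?_)
    rw [mul_assoc, ← Real.rpow_add_one hQ0.ne']
    congr 1; ring
  have hQκ : Q ^ (-(κ / 4)) ≤ Cκ / (1 + LQ) ^ 10 := hCκb Q hQ1
  -- the two amplitudes
  set A₁ : ℝ := 2 * (1 + L) ^ 2 * (C₁ * (Real.sqrt 2 * Q ^ (-(κ / 4)))) with hA₁
  set A₂ : ℝ := 2 * (1 + L) ^ 2 * (2 * (C₂ * (2 / κ) ^ 12 / LQ ^ 12) * (W₁ + 2 + 4 * L + 2 * LQ))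
    with hA₂
  have hA₁0 : 0 ≤ A₁ := by positivity
  have hA₂0 : 0 ≤ A₂ := by positivity
  -- the per-term bound
  have hterm : ∀ c ∈ Icc 1 N, ∀ d ∈ Icc 1 (N / c),
      |(μ d : ℝ) * c * W (c * d) ^ 2 / Real.log M ^ 4 * cornerU M Q (c * d) d| ≤
        divWeight (c * d) / ((c : ℝ) * d) * A₁ + divWeight (c * d) / ((c : ℝ) * d ^ 2) * A₂ := by
    intro c hc d hd
    have hc1 := (Finset.mem_Icc.1 hc).1
    have hd1 := (Finset.mem_Icc.1 hd).1
    have hdN : d ≤ N := (Finset.mem_Icc.1 hd).2.trans (Nat.div_le_self N c)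
    have hc0 : (0 : ℝ) < c := by exact_mod_cast hc1
    have hd0 : (0 : ℝ) < d := by exact_mod_cast hd1
    have hcd0 : c * d ≠ 0 := by positivity
    have hn0 : (0 : ℝ) < ((c * d : ℕ) : ℝ) := by positivity
    -- n = cd ≤ N ≤ M
    have hnN : c * d ≤ N := by
      have := (Finset.mem_Icc.1 hd).2
      calc c * d ≤ c * (N / c) := Nat.mul_le_mul_left c this
        _ ≤ N := Nat.mul_div_le N c
    have hnM : ((c * d : ℕ) : ℝ) ≤ M := le_trans (by exact_mod_cast hnN) hNM
    have hD := divWeight_nonneg (c * d)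
    -- Y = M/n ∈ [1, M]
    have hY1 : 1 ≤ M / ((c * d : ℕ) : ℝ) := by rw [le_div_iff₀ hn0]; linarith
    have hYM : M / ((c * d : ℕ) : ℝ) ≤ M := div_le_self hM0.le (by exact_mod_cast Nat.one_le_iff_ne_zero.2 hcd0)
    have hlogY0 : 0 ≤ Real.log (M / ((c * d : ℕ) : ℝ)) := Real.log_nonneg hY1
    have hlogY : Real.log (M / ((c * d : ℕ) : ℝ)) ≤ L := Real.log_le_log (by positivity) hYM
    -- the U bound at K₁
    have hUb := hU (c * d) hcd0 d (by omega) Q M hQ0 hnM K₁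
    -- |μ d · c · W(n)²| ≤ c/n²
    have hW : W (c * d) ^ 2 ≤ (((c * d : ℕ) : ℝ))⁻¹ ^ 2 := by
      rw [← sq_abs]; exact pow_le_pow_left₀ (abs_nonneg _) (abs_W_le (c * d)) 2
    have hμ : |(μ d : ℝ)| ≤ 1 := by exact_mod_cast ArithmeticFunction.abs_moebius_le_one
    -- pieces of the bracket
    have hlog4 : 2 * Real.log (M / ((c * d : ℕ) : ℝ)) ^ 4 * (1 + Real.log (M / ((c * d : ℕ) : ℝ))) ^ 2 ≤
        2 * L ^ 4 * (1 + L) ^ 2 := by gcongr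
    have hR : Real.sqrt (2 * ((d : ℝ) ^ 2 / Q ^ 2) * K₁ * (M / ((c * d : ℕ) : ℝ))) ≤
        d * (Real.sqrt 2 * Q ^ (-(κ / 4))) := by
      have h1 : 2 * ((d : ℝ) ^ 2 / Q ^ 2) * K₁ * (M / ((c * d : ℕ) : ℝ)) ≤ (d * (Real.sqrt (2 * K₁ * M) / Q)) ^ 2 := by
        rw [mul_pow, div_pow, Real.sq_sqrt (by positivity)]
        have hK0 : (0 : ℝ) ≤ K₁ := Nat.cast_nonneg _
        have : M / ((c * d : ℕ) : ℝ) ≤ M := hYM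
        have e : (d : ℝ) ^ 2 * (2 * K₁ * M / Q ^ 2) = 2 * ((d : ℝ) ^ 2 / Q ^ 2) * K₁ * M := by ring
        rw [e]
        gcongr
      calc Real.sqrt (2 * ((d : ℝ) ^ 2 / Q ^ 2) * K₁ * (M / ((c * d : ℕ) : ℝ)))
          ≤ Real.sqrt ((d * (Real.sqrt (2 * K₁ * M) / Q)) ^ 2) := Real.sqrt_le_sqrt h1
        _ = d * (Real.sqrt (2 * K₁ * M) / Q) := Real.sqrt_sq (by positivity)
        _ ≤ d * (Real.sqrt 2 * Q ^ (-(κ / 4))) := mul_le_mul_of_nonneg_left hb hd0.le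
    have hG : scriptW 1 + 2 + |Real.log ((d : ℝ) ^ 2 / Q ^ 2)| + 2 * Real.log (M / ((c * d : ℕ) : ℝ)) ≤
        W₁ + 2 + 4 * L + 2 * LQ := by
      have hlogd : Real.log (d : ℝ) ≤ L :=
        (Real.log_le_log hd0 (by exact_mod_cast hdN)).trans hlogN
      have hlogd0 : 0 ≤ Real.log (d : ℝ) := Real.log_nonneg (by exact_mod_cast hd1)
      have habs : |Real.log ((d : ℝ) ^ 2 / Q ^ 2)| ≤ 2 * L + 2 * LQ := by
        rw [Real.log_div (by positivity) (by positivity), Real.log_pow, Real.log_pow]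
        push_cast
        refine (abs_sub _ _).trans ?_
        rw [abs_of_nonneg (by positivity), abs_of_nonneg (by positivity)]
        linarith
      rw [hW₁]; linarith
    -- combine
    have hbracket : C₁ * Real.sqrt (2 * ((d : ℝ) ^ 2 / Q ^ 2) * K₁ * (M / ((c * d : ℕ) : ℝ))) +
        2 * (C₂ / (1 + Real.log (K₁ : ℝ)) ^ 12) *
          (scriptW 1 + 2 + |Real.log ((d : ℝ) ^ 2 / Q ^ 2)| + 2 * Real.log (M / ((c * d : ℕ) : ℝ))) ≤
        d * (C₁ * (Real.sqrt 2 * Q ^ (-(κ / 4)))) +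
          2 * (C₂ * (2 / κ) ^ 12 / LQ ^ 12) * (W₁ + 2 + 4 * L + 2 * LQ) := by
      have h1 : C₁ * Real.sqrt (2 * ((d : ℝ) ^ 2 / Q ^ 2) * K₁ * (M / ((c * d : ℕ) : ℝ))) ≤
          d * (C₁ * (Real.sqrt 2 * Q ^ (-(κ / 4)))) := by
        have := mul_le_mul_of_nonneg_left hR hC₁.le; linarith
      have hGpos : 0 ≤ scriptW 1 + 2 + |Real.log ((d : ℝ) ^ 2 / Q ^ 2)| +
          2 * Real.log (M / ((c * d : ℕ) : ℝ)) := by rw [← hW₁]; positivity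
      have h2 := mul_le_mul (mul_le_mul_of_nonneg_left hcK zero_le_two) hG hGpos (by positivity)
      linarith
    -- |term| ≤ c/n² /L⁴ · D · (2L⁴(1+L)²) · bracket
    have hU' : |cornerU M Q (c * d) d| ≤ divWeight (c * d) * (2 * L ^ 4 * (1 + L) ^ 2) *
        (d * (C₁ * (Real.sqrt 2 * Q ^ (-(κ / 4)))) +
          2 * (C₂ * (2 / κ) ^ 12 / LQ ^ 12) * (W₁ + 2 + 4 * L + 2 * LQ)) := by
      refine hUb.trans ?_
      have hbpos : 0 ≤ C₁ * Real.sqrt (2 * ((d : ℝ) ^ 2 / Q ^ 2) * K₁ * (M / ((c * d : ℕ) : ℝ))) +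
          2 * (C₂ / (1 + Real.log (K₁ : ℝ)) ^ 12) *
            (scriptW 1 + 2 + |Real.log ((d : ℝ) ^ 2 / Q ^ 2)| + 2 * Real.log (M / ((c * d : ℕ) : ℝ))) := by
        positivity
      exact mul_le_mul (mul_le_mul_of_nonneg_left hlog4 hD) hbracket hbpos (by positivity)
    have hcoef : |(μ d : ℝ) * c * W (c * d) ^ 2 / Real.log M ^ 4| ≤ c * (((c * d : ℕ) : ℝ))⁻¹ ^ 2 / L ^ 4 := by
      rw [abs_div, abs_mul, abs_mul, abs_of_pos hc0, abs_of_nonneg (sq_nonneg (W (c * d))),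
        abs_of_pos (by positivity : (0 : ℝ) < Real.log M ^ 4)]
      apply div_le_div_of_nonneg_right _ (by positivity)
      calc |(μ d : ℝ)| * c * W (c * d) ^ 2 ≤ 1 * c * (((c * d : ℕ) : ℝ))⁻¹ ^ 2 := by
            gcongr
        _ = c * (((c * d : ℕ) : ℝ))⁻¹ ^ 2 := by ring
    rw [abs_mul]
    refine (mul_le_mul hcoef hU' (abs_nonneg _) (by positivity)).trans (le_of_eq ?_)
    have hLne : L ≠ 0 := hL0.ne'
    have hcne : (c : ℝ) ≠ 0 := hc0.ne'
    have hdne : (d : ℝ) ≠ 0 := hd0.ne'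
    rw [hA₁, hA₂]
    push_cast
    field_simp
  -- sum the per-term bounds
  rw [corner_eq_sum hM1 hQ0]
  have hsum : |∑ c ∈ Icc 1 N, ∑ d ∈ Icc 1 (N / c),
      (μ d : ℝ) * c * W (c * d) ^ 2 / Real.log M ^ 4 * cornerU M Q (c * d) d| ≤
      A₁ * (1 + Real.log N) ^ 4 + A₂ * (Z₂ * (2 + Real.log N)) := by
    calc |∑ c ∈ Icc 1 N, ∑ d ∈ Icc 1 (N / c),
          (μ d : ℝ) * c * W (c * d) ^ 2 / Real.log M ^ 4 * cornerU M Q (c * d) d|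
        ≤ ∑ c ∈ Icc 1 N, ∑ d ∈ Icc 1 (N / c),
          |(μ d : ℝ) * c * W (c * d) ^ 2 / Real.log M ^ 4 * cornerU M Q (c * d) d| := by
          refine (Finset.abs_sum_le_sum_abs _ _).trans (Finset.sum_le_sum fun c _ ↦ ?_)
          exact Finset.abs_sum_le_sum_abs _ _
      _ ≤ ∑ c ∈ Icc 1 N, ∑ d ∈ Icc 1 (N / c),
          (divWeight (c * d) / ((c : ℝ) * d) * A₁ + divWeight (c * d) / ((c : ℝ) * d ^ 2) * A₂) :=
          Finset.sum_le_sum fun c hc ↦ Finset.sum_le_sum fun d hd ↦ hterm c hc d hd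
      _ = (∑ c ∈ Icc 1 N, ∑ d ∈ Icc 1 (N / c), divWeight (c * d) / ((c : ℝ) * d)) * A₁ +
          (∑ c ∈ Icc 1 N, ∑ d ∈ Icc 1 (N / c), divWeight (c * d) / ((c : ℝ) * d ^ 2)) * A₂ := by
          rw [Finset.sum_mul, Finset.sum_mul, ← Finset.sum_add_distrib]
          refine Finset.sum_congr rfl fun c _ ↦ ?_
          rw [Finset.sum_mul, Finset.sum_mul, ← Finset.sum_add_distrib]
      _ ≤ (1 + Real.log N) ^ 4 * A₁ + (Z₂ * (2 + Real.log N)) * A₂ :=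
          add_le_add (mul_le_mul_of_nonneg_right (sum_sum_divWeight_div_mul_le N) hA₁0)
            (mul_le_mul_of_nonneg_right (sum_sum_divWeight_div_mul_sq_le hN1) hA₂0)
      _ = A₁ * (1 + Real.log N) ^ 4 + A₂ * (Z₂ * (2 + Real.log N)) := by ring
  have hq0 : 0 ≤ Q ^ (-(κ / 4)) := by positivity
  exact hsum.trans (corner_tail_le hC₁ hC₂ hCκ hW₁0 hZ₂0 hκ (by linarith) hL0 hLLQ hlogN0 hlogN hq0 hQκ
    hA₁ hA₂ hCtot)

/-- **H1 (`CornerNegligibleXSq`, the STUB-PLAN's corner lemma, critic's shape up to the spelling of the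
weights).** For `1 < Δ′ < 2` and `ε > 0`, for all large `q`: at `M = q̂^{Δ′}`, `Q = q̂`
(`q̂ = √q/(2π)`), the `X²` quadratic form of the TRUE diagonal kernel minus the CONTINUED KMV kernel is
at most `ε·mainScaleReal Δ′ q/(2q̂)` in absolute value — so `2q̂ ×` the corner is `≤ ε·mainScaleReal`,
negligible against the second-moment scale. Valid for every `q` (prime or not).
[cite: KowalskiMichelVanderKam2000, (21)–(23), Prop. 5.1 — derivation (the corner of the diagonal at prime level, P = X²)] -/
theorem cornerNegligibleXSq {Δ' : ℝ} (h1 : 1 < Δ') (h2 : Δ' < 2) {ε : ℝ} (hε : 0 < ε) :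
    ∃ q₀ : ℕ, ∀ q : ℕ, q₀ ≤ q →
      |∑ m₁ ∈ Icc 1 ⌊qhat q ^ Δ'⌋₊, ∑ m₂ ∈ Icc 1 ⌊qhat q ^ Δ'⌋₊,
          xsq (qhat q ^ Δ') m₁ * xsq (qhat q ^ Δ') m₂ *
            (trueDiagKernel (qhat q) m₁ m₂ - kmvKernel (Real.log (qhat q)) m₁ m₂)| ≤
        ε * mainScaleReal Δ' q / (2 * qhat q) := by
  obtain ⟨C, hC, hmain⟩ := abs_corner_le (κ := 2 - Δ') (by linarith)
  set ζ2 : ℝ := π ^ 2 / 6 with hζ2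
  have hζ2pos : 0 < ζ2 := by positivity
  -- thresholds: q̂ ≥ 2 and Δ' log q̂ ≥ max (log 2) (C/(ε ζ2²))
  set T : ℝ := max 2 (Real.exp (max (Real.log 2) (C / (ε * ζ2 ^ 2)))) with hT
  refine ⟨⌈(2 * π * T) ^ 2⌉₊, fun q hq ↦ ?_⟩
  have hT2 : 2 ≤ T := le_max_left _ _
  have hT0 : 0 < T := by linarith
  set s : ℝ := qhat q with hs
  have hsT : T ≤ s := by
    have hqR : (2 * π * T) ^ 2 ≤ (q : ℝ) := (Nat.le_ceil _).trans (by exact_mod_cast hq)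
    have h2π : 0 < 2 * π := by positivity
    have hsq : 2 * π * T ≤ Real.sqrt q := by
      rw [show (2 * π * T : ℝ) = Real.sqrt ((2 * π * T) ^ 2) by rw [Real.sqrt_sq (by positivity)]]
      exact Real.sqrt_le_sqrt hqR
    rw [hs, qhat, le_div_iff₀ h2π]
    linarith
  have hs2 : 2 ≤ s := hT2.trans hsT
  have hs0 : 0 < s := by linarith
  have hlogs : max (Real.log 2) (C / (ε * ζ2 ^ 2)) ≤ Real.log s := by
    have : Real.exp (max (Real.log 2) (C / (ε * ζ2 ^ 2))) ≤ s := (le_max_right _ _).trans hsT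
    simpa [Real.log_exp] using Real.log_le_log (Real.exp_pos _) this
  set M : ℝ := s ^ Δ' with hMdef
  have hM : Real.log M = Δ' * Real.log s := Real.log_rpow hs0 Δ'
  have hlogs0 : 0 < Real.log s := Real.log_pos (by linarith)
  have hM2 : 2 ≤ M := by
    have h : Real.log 2 ≤ Real.log M := by
      rw [hM]
      have := (le_max_left _ _).trans hlogs
      nlinarith
    exact (Real.log_le_log_iff two_pos (by positivity)).1 h
  have hMQ : M ≤ s ^ (2 - (2 - Δ')) := by rw [hMdef]; norm_num
  have hb := hmain s M hs2 hM2 hMQ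
  refine hb.trans ?_
  -- C / log³M ≤ ε · mainScaleReal/(2q̂) = ε ζ2²/(Δ'² log² s)
  have hms : mainScaleReal Δ' q = 2 * ζ2 ^ 2 * (s / (Δ' ^ 2 * Real.log s ^ 2)) := by
    simp only [mainScaleReal, hs, qhat, hζ2]
  have hrhs : ε * mainScaleReal Δ' q / (2 * qhat q) = ε * ζ2 ^ 2 / (Δ' * Real.log s) ^ 2 := by
    rw [hms, ← hs]; field_simp
  rw [hrhs, hM]
  have hLpos : 0 < Δ' * Real.log s := by positivity
  rw [div_le_div_iff₀ (by positivity) (by positivity)]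
  have hC' : C ≤ ε * ζ2 ^ 2 * (Δ' * Real.log s) := by
    have h := (le_max_right _ _).trans hlogs
    rw [div_le_iff₀ (by positivity)] at h
    nlinarith
  nlinarith [pow_pos hLpos 2]

end Summit.Parity.GeneralizedHardyLittlewood.Theorems.BeyondDiagonalBeatsQuarter.Corner
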